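import Summits.BirchSwinnertonDyer.BirchSwinnertonDyer.Theorems.KolyvaginRoadThreeZhangSupplyLocalConj
import HarnessLib

/-!
# Route `KolyvaginRoadThree`, deciding crux `ZhangSharpFrameAtThreeHL` (item stmt-BirchSwinnertonDyer-19574):
# (E1′) — at a place FIXED by an involution `σ` (an INERT prime for complex conjugation) the local conjugation
# transport of part VI is an INVOLUTION of `H¹(Γ_{K_v}, E(K̄_{K_v})[n])` compatible with `σ_* = conjAct W σ n`
# — the local `τ`-action whose eigenspaces the SIGNED supply (part V) needs
# (cell `bsd-stepL`, ACCEL seat `bsd-stepL-koly3b` g4; `--supports stmt-BirchSwinnertonDyer-19574`, helper; part VII of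
# the (Supply) series; part VI = `KolyvaginRoadThreeZhangSupplyLocalConj.lean`, p498969)

HONEST FRAMING. Theorems only; no definition, no named fact, no `sorry`; nothing at `p = 3 ∥ N` is asserted. PARTITION:
O2@3 (B10) × A1 × crux 19574 — none (engine input; types nothing, closes nothing; T7).

CONTENT. Part VI produced, for `σ ∈ Aut(K/ℚ)` and a `σ`-semilinear `θ : E ≃+* E'`, an injective transport
`Φ : H¹(Γ_E, E(K̄_E)[n]) → H¹(Γ_{E'}, E(K̄_{E'})[n])` with `Φ ∘ loc_E = loc_{E'} ∘ σ_*`, as an existential. Here: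
* `transport_torsionLocMap_apply` — the same identity for the EXPLICIT transport attached to ANY lift `Θ` of `θ` and
  any torsion-level `ψ` over `localPointsMap W Θ` (part VI proved it inside the existential for the chosen lift);
* **`transport_transport_eq_self`** — when `E' = E` and `θ ∘ θ = id` (so `Θ ∘ Θ` is an `E`-automorphism `γ ∈ Γ_E` of
  `K̄_E`), `Φ ∘ Φ = id`: the composite pair `(Θ⁻¹(Θ⁻¹ · Θ)Θ, Θ ∘ Θ)` is the INNER pair of `γ`, which acts trivially
  on `H¹` (`map_one_eq_of_conj_comp`, Serre *Corps locaux* VII §5 Prop. 3);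
* **`exists_involutive_transport_torsionLocMap_adicCompletion`** — for an involution `σ` (`σ * σ = 1`) and a finite
  place `v` with `σ • v = v`: an additive INVOLUTION `Φ_v` of `H¹(Γ_{K_v}, E(K̄_{K_v})[n])` with
  `Φ_v (loc_v s) = loc_v (σ_* s)` — Gross's action of `τ` on `H¹(K_λ, E_p)` at an inert `λ` (LMS 153 (1991) §5 (5.1),
  Prop. 8.2), in the method skeleton's `torsionLocMap` model. Its `±`-eigen-subgroups are the local signed spaces of
  McCallum's Lemma 5.3.

What this does NOT do: (E2) invariance of the local pairings under `Φ_v`, (E3) the signed local counts, (E4) Weil.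

References: [cite: SerreLocalFields1979, VII §5 Prop. 3] [cite: GrossLMS1991, §5 (5.1), Prop. 8.2]
[cite: McCallumLMS1991, Lemma 5.3 (p. 303)] [cite: CasselsFrohlichANT1967, Ch. VII §1.1].
-/

noncomputable section

open scoped Classical

universe u

namespace Summit.BirchSwinnertonDyer.Rank1Residual.X11b.Three.Koly.ZhangSupply.LocalConj

open CategoryTheory WeierstrassCurve Field Function NumberField IsDedekindDomain
open Literature.NumberTheory.EllipticCurves Literature.NumberTheory.Automorphic
open Literature.NumberTheory.GaloisRepresentations

section Apply

variable {K : Type u} [Field K] [CharZero K] (W : WeierstrassCurve ℚ)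
variable {E E' : Type u} [Field E] [Algebra K E] [Field E'] [Algebra K E'] [CharZero E] [CharZero E']

/-- **The transport identity for an ARBITRARY lift.** For `σ ∈ Aut(K/ℚ)`, a `σ`-semilinear `θ : E ≃+* E'`, ANY lift
`Θ` of `θ` to the algebraic closures and any torsion-level `ψ` over `localPointsMap W Θ`, the map `Φ_{Θ,ψ}` on `H¹`
along the pair `(Θ⁻¹(·)Θ, ψ)` satisfies `Φ_{Θ,ψ} (loc_E s) = loc_{E'} (σ_* s)` (part VI's proof, verbatim, for the given
lift). [cite: SerreGaloisCohomology1997, I §2.4, II §1.1] [cite: GrossLMS1991, §5 (5.1)] -/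
theorem transport_torsionLocMap_apply (σ : K ≃ₐ[ℚ] K) {θ : E ≃+* E'} (hθ : IsSemilinearRingEquiv σ θ)
    {Θ : AlgebraicClosure E ≃+* AlgebraicClosure E'} (hΘ : IsLiftOfRingEquiv θ Θ) (n : ℤ)
    (ψ : AddSubgroup.torsionBy (localPoints (W.baseChange K) E) n →+
      AddSubgroup.torsionBy (localPoints (W.baseChange K) E') n)
    (hψ : ∀ P, (ψ P : localPoints (W.baseChange K) E') = localPointsMap (K := K) W Θ P)
    (s : galH1Torsion (W.baseChange K) n) :
    (ContinuousCohomology.map hΘ.conjGalCMH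
        (resHomOfEquivariant hΘ.conjGalCMH ψ (smul_of_coe_eq_localPointsMap W hΘ ψ hψ)) 1).hom.toLinearMap.toAddMonoidHom
        ((W.baseChange K).torsionLocMap E n s) =
      (W.baseChange K).torsionLocMap E' n (conjAct W σ n s) := by
  have hτ : IsLiftOfAut σ (liftAut σ) := isLiftOfAut_liftAut σ
  set ι' := embOfLifts hτ hθ hΘ with hι'
  -- the torsion points map along `ι'`
  obtain ⟨ψι, hψι⟩ : ∃ ψι : geomTorsion (W.baseChange K) n →+
      AddSubgroup.torsionBy (localPoints (W.baseChange K) E') n,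
      ∀ P, (ψι P : localPoints (W.baseChange K) E') = pointsMapOfEmb (W.baseChange K) ι' P := by
    refine ⟨((pointsMapOfEmb (W.baseChange K) ι').comp (geomTorsion (W.baseChange K) n).subtype).codRestrict _
      fun P ↦ ?_, fun P ↦ rfl⟩
    have hP : n • (P : geomPoints (W.baseChange K)) = 0 := (mem_geomTorsion_iff (W.baseChange K) n _).mp P.2
    change pointsMapOfEmb (W.baseChange K) ι' (P : geomPoints (W.baseChange K)) ∈
      (Submodule.torsionBy ℤ (localPoints (W.baseChange K) E') n).toAddSubgroup
    rw [Submodule.mem_toAddSubgroup, Submodule.mem_torsionBy_iff, ← map_zsmul, hP, map_zero]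
  have hsmulι : ∀ (g : absoluteGaloisGroup E') (P : geomTorsion (W.baseChange K) n),
      ψι (resGalOfEmb ι' g • P) = g • ψι P := fun g P ↦ Subtype.ext (by
    rw [hψι, Literature.NumberTheory.EllipticCurves.AddSubgroup.torsionBy.coe_smul,
      Literature.NumberTheory.EllipticCurves.AddSubgroup.torsionBy.coe_smul, hψι]
    exact pointsMapOfEmb_smul _ ι' g _)
  -- (A) `loc_{E', ι'} ∘ σ_*` as ONE compatible pair
  have hA := map_one_eq_comp_of_eq hτ.conjGalCMH (hτ.torsionMap W n) (hτ.torsionMap_smul W n)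
    (resGalOfEmb ι') ψι hsmulι
    (Φ := hτ.conjGalCMH.comp (resGalOfEmb ι')) (Ψ := ψι.comp (hτ.torsionMap W n))
    (fun g P ↦ by
      rw [AddMonoidHom.comp_apply, ContinuousMonoidHom.comp_toFun, hτ.torsionMap_smul W n, hsmulι,
        AddMonoidHom.comp_apply]) rfl rfl
  -- (B) `Φ ∘ loc_E` as ONE compatible pair
  have hB := map_one_eq_comp_of_eq (resGal (K := K) E) (torsionPointsMap (W.baseChange K) E n)
    (torsionPointsMap_smul (W.baseChange K) E n) hΘ.conjGalCMH ψ (smul_of_coe_eq_localPointsMap W hΘ ψ hψ)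
    (Φ := (resGal (K := K) E).comp hΘ.conjGalCMH) (Ψ := ψ.comp (torsionPointsMap (W.baseChange K) E n))
    (fun g P ↦ by
      rw [AddMonoidHom.comp_apply, ContinuousMonoidHom.comp_toFun, torsionPointsMap_smul,
        smul_of_coe_eq_localPointsMap W hΘ ψ hψ, AddMonoidHom.comp_apply]) rfl rfl
  -- the two composite pairs agree on the nose
  have hcoef : ψι.comp (hτ.torsionMap W n) = ψ.comp (torsionPointsMap (W.baseChange K) E n) := by
    refine AddMonoidHom.ext fun P ↦ Subtype.ext ?_
    rw [AddMonoidHom.comp_apply, AddMonoidHom.comp_apply, hψι, hψ, coe_torsionPointsMap]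
    have h := congr($(pointsMapOfEmb_embOfLifts_comp_torsionMap W hτ hθ hΘ n) P)
    simpa only [AddMonoidHom.coe_comp, AddSubgroup.coe_subtype, Function.comp_apply] using h
  have hAB := map_one_pair_congr (conjGalCMH_comp_resGalOfEmb_embOfLifts hτ hθ hΘ) hcoef
    (fun g P ↦ by
      rw [AddMonoidHom.comp_apply, ContinuousMonoidHom.comp_toFun, hτ.torsionMap_smul W n, hsmulι,
        AddMonoidHom.comp_apply])
    (fun g P ↦ by
      rw [AddMonoidHom.comp_apply, ContinuousMonoidHom.comp_toFun, torsionPointsMap_smul,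
        smul_of_coe_eq_localPointsMap W hΘ ψ hψ, AddMonoidHom.comp_apply])
  rw [hA, hB, map_torsion_eq_of_algHom W ι' n ψι hψι hsmulι] at hAB
  -- evaluate at `s`
  rw [← hτ.conjH1_eq_conjAct W n]
  unfold WeierstrassCurve.torsionLocMap IsLiftOfAut.conjH1
  simp only [LinearMap.toAddMonoidHom_coe, ContinuousLinearMap.coe_coe]
  rw [← ConcreteCategory.comp_apply, ← ConcreteCategory.comp_apply, hAB]

end Apply

/-! ## The involution at a fixed field -/

section Involution

variable {K : Type u} [Field K] [CharZero K] (W : WeierstrassCurve ℚ)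
variable {E : Type u} [Field E] [Algebra K E] [CharZero E]

/-- **`Φ ∘ Φ = id` for an involutive `θ`.** Let `θ : E ≃+* E` with `θ (θ e) = e` for all `e`, `Θ` a lift of `θ` to
`K̄_E` and `ψ` its torsion-level map. Then `Θ ∘ Θ` is an `E`-automorphism `γ ∈ Γ_E` of `K̄_E`, the composite of the
pair `(Θ⁻¹(·)Θ, ψ)` with itself is the INNER pair `(γ⁻¹(·)γ, γ • ·)`, and inner pairs act trivially on `H¹`: the
transport `Φ_{Θ,ψ}` of `H¹(Γ_E, E(K̄_E)[n])` is an involution. [cite: SerreLocalFields1979, VII §5 Prop. 3] -/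
theorem transport_transport_eq_self {θ : E ≃+* E} (hθθ : ∀ e, θ (θ e) = e)
    {Θ : AlgebraicClosure E ≃+* AlgebraicClosure E} (hΘ : IsLiftOfRingEquiv θ Θ) {n : ℤ}
    (ψ : AddSubgroup.torsionBy (localPoints (W.baseChange K) E) n →+
      AddSubgroup.torsionBy (localPoints (W.baseChange K) E) n)
    (hψ : ∀ P, (ψ P : localPoints (W.baseChange K) E) = localPointsMap (K := K) W Θ P)
    (x : discreteH1 (absoluteGaloisGroup E) (AddSubgroup.torsionBy (localPoints (W.baseChange K) E) n)) :
    ContinuousCohomology.map hΘ.conjGalCMH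
        (resHomOfEquivariant hΘ.conjGalCMH ψ (smul_of_coe_eq_localPointsMap W hΘ ψ hψ)) 1
      (ContinuousCohomology.map hΘ.conjGalCMH
        (resHomOfEquivariant hΘ.conjGalCMH ψ (smul_of_coe_eq_localPointsMap W hΘ ψ hψ)) 1 x) = x := by
  -- `γ = Θ ∘ Θ ∈ Γ_E`
  let γ : absoluteGaloisGroup E :=
    { Θ.trans Θ with
      commutes' := fun e ↦ by
        change Θ (Θ (algebraMap E (AlgebraicClosure E) e)) = algebraMap E (AlgebraicClosure E) e
        rw [hΘ, hΘ, hθθ] }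
  have hγ : ∀ y : AlgebraicClosure E, (show AlgebraicClosure E ≃ₐ[E] AlgebraicClosure E from γ) y = Θ (Θ y) :=
    fun _ ↦ rfl
  have hsmul := smul_of_coe_eq_localPointsMap W hΘ ψ hψ
  -- compatibility of the composite pair
  have hh : ∀ (g : absoluteGaloisGroup E) (P : AddSubgroup.torsionBy (localPoints (W.baseChange K) E) n),
      (ψ.comp ψ) ((hΘ.conjGalCMH.comp hΘ.conjGalCMH) g • P) = g • (ψ.comp ψ) P := fun g P ↦ by
    rw [AddMonoidHom.comp_apply, ContinuousMonoidHom.comp_toFun, hsmul, hsmul, AddMonoidHom.comp_apply]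
  -- the composite pair is the inner pair of `γ`
  have hφ : hΘ.conjGalCMH.comp hΘ.conjGalCMH = (conjCMH γ).comp (ContinuousMonoidHom.id _) := by
    refine ContinuousMonoidHom.ext fun g ↦ AlgEquiv.ext fun y ↦ ?_
    -- both sides are `Θ⁻¹ (Θ⁻¹ (g (Θ (Θ y))))` by construction
    change Θ.symm (Θ.symm ((show AlgebraicClosure E ≃ₐ[E] AlgebraicClosure E from g) (Θ (Θ y)))) =
      Θ.symm (Θ.symm ((show AlgebraicClosure E ≃ₐ[E] AlgebraicClosure E from g) (Θ (Θ y))))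
    rfl
  have hψψ : ψ.comp ψ = (AddMonoidHom.id _).comp
      (DistribSMul.toAddMonoidHom (AddSubgroup.torsionBy (localPoints (W.baseChange K) E) n) γ) := by
    refine AddMonoidHom.ext fun P ↦ Subtype.ext ?_
    rw [AddMonoidHom.comp_apply, hψ, hψ, AddMonoidHom.comp_apply, AddMonoidHom.id_apply,
      DistribSMul.toAddMonoidHom_apply, Literature.NumberTheory.EllipticCurves.AddSubgroup.torsionBy.coe_smul,
      localPoints.smul_def]
    generalize (P : localPoints (W.baseChange K) E) = Q
    change ((W.baseChange K).baseChange (AlgebraicClosure E)).toAffine.Point at Q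
    rcases Q with _ | ⟨x₁, y₁, hxy⟩
    · change localPointsMap (K := K) W Θ (localPointsMap (K := K) W Θ (0 : localPoints (W.baseChange K) E)) =
        WeierstrassCurve.Affine.Point.map _ (0 : localPoints (W.baseChange K) E)
      rw [localPointsMap_zero, localPointsMap_zero]
      exact (map_zero _).symm
    · rw [localPointsMap_some, localPointsMap_some, WeierstrassCurve.Affine.Point.map_some]
      exact Affine.Point.some_eq_some_of_eq rfl rfl
  -- `Φ ≫ Φ = H¹(inner pair) = H¹(id pair) = 𝟙`
  have hcomp := map_one_eq_comp_of_eq hΘ.conjGalCMH ψ hsmul hΘ.conjGalCMH ψ hsmul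
    (Φ := hΘ.conjGalCMH.comp hΘ.conjGalCMH) (Ψ := ψ.comp ψ) hh rfl rfl
  have hinner := map_one_eq_of_conj_comp (ContinuousMonoidHom.id (absoluteGaloisGroup E))
    (AddMonoidHom.id (AddSubgroup.torsionBy (localPoints (W.baseChange K) E) n)) (fun _ _ ↦ rfl) γ hh hφ hψψ
  rw [map_one_eq_id_of_eq (fun _ _ ↦ rfl) rfl rfl] at hinner
  rw [hinner] at hcomp
  have hx := congr($hcomp x)
  simp only [ConcreteCategory.id_apply, ConcreteCategory.comp_apply] at hx
  exact hx.symm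

end Involution

/-! ## The involution at an inert place -/

section Completion

variable {K : Type} [Field K] [NumberField K] (W : WeierstrassCurve ℚ)

/-- **(E1′) Gross's local `τ` at a fixed place.** For an involution `σ ∈ Aut(K/ℚ)` (`σ * σ = 1`; complex conjugation
of an imaginary quadratic `K`) and a finite place `v` with `σ • v = v` (inert or ramified), there is an additive
INVOLUTION `Φ_v` of `H¹(Γ_{K_v}, E(K̄_{K_v})[n])` with `Φ_v (loc_v s) = loc_v (σ_* s)` for all `s ∈ H¹(K, E[n])`
(`loc_v = torsionLocMap (K_v)`, `σ_* = conjAct W σ n`) — the local conjugation action of Gross 1991 §5 (5.1) ∕ Prop. 8.2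
at an inert `λ`, whose `±`-eigen-subgroups are McCallum's `H¹(K_λ, E)^±` (Lemma 5.3). Built from the Galois transport of
completions `σ_v : K_v ≃+* K_v` (`galAdicCompletionEquiv`; involutive by the cocycle law
`galAdicCompletionMap_galAdicCompletionMap` and `σ * σ = 1`), part VI's transport, and `transport_transport_eq_self`.
[cite: GrossLMS1991, §5 (5.1), Prop. 8.2] [cite: McCallumLMS1991, Lemma 5.3 (p. 303)] [cite: CasselsFrohlichANT1967, Ch. VII §1.1] -/
theorem exists_involutive_transport_torsionLocMap_adicCompletion (σ : K ≃ₐ[ℚ] K) (hσ : σ * σ = 1)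
    {v : HeightOneSpectrum (𝓞 K)} (h : σ • v = v) (n : ℤ) :
    ∃ Φ : discreteH1 (absoluteGaloisGroup (v.adicCompletion K))
          (AddSubgroup.torsionBy (localPoints (W.baseChange K) (v.adicCompletion K)) n) →+
        discreteH1 (absoluteGaloisGroup (v.adicCompletion K))
          (AddSubgroup.torsionBy (localPoints (W.baseChange K) (v.adicCompletion K)) n),
      (∀ x, Φ (Φ x) = x) ∧ ∀ s : galH1Torsion (W.baseChange K) n,
        Φ ((W.baseChange K).torsionLocMap (v.adicCompletion K) n s) =
          (W.baseChange K).torsionLocMap (v.adicCompletion K) n (conjAct W σ n s) := by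
  haveI : CharZero (v.adicCompletion K) := charZero_of_injective_algebraMap (algebraMap K _).injective
  set θ := galAdicCompletionEquiv (L := K) σ h with hθdef
  have hθ : IsSemilinearRingEquiv σ θ := isSemilinearRingEquiv_galAdicCompletionEquiv σ h
  have hθθ : ∀ e, θ (θ e) = e := fun e ↦ by
    rw [hθdef, coe_galAdicCompletionEquiv, galAdicCompletionMap_galAdicCompletionMap,
      galAdicCompletionMap_congr_left K hσ _ (one_smul _ v), galAdicCompletionMap_one]
  have hΘ : IsLiftOfRingEquiv θ (ringEquivLift θ) := isLiftOfRingEquiv_ringEquivLift θ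
  obtain ⟨ψ, hψ⟩ := exists_torsionBy_map (K := K) W (ringEquivLift θ) n
  refine ⟨(ContinuousCohomology.map hΘ.conjGalCMH
      (resHomOfEquivariant hΘ.conjGalCMH ψ (smul_of_coe_eq_localPointsMap W hΘ ψ hψ)) 1).hom.toLinearMap.toAddMonoidHom,
    fun x ↦ ?_, fun s ↦ transport_torsionLocMap_apply W σ hθ hΘ n ψ hψ s⟩
  have hx := transport_transport_eq_self (K := K) W hθθ hΘ ψ hψ x
  simpa only [LinearMap.toAddMonoidHom_coe, ContinuousLinearMap.coe_coe] using hx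

end Completion

end Summit.BirchSwinnertonDyer.Rank1Residual.X11b.Three.Koly.ZhangSupply.LocalConj

end
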